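import Mathlib
import HarnessLib
import Summits.Ventures.LatticeQCDFlow.Scaling.AcceptanceMidpointLaw
import Summits.Ventures.LatticeQCDFlow.Scaling.PiKernelSecondMoment

/-!
# LatticeQCDFlow / Scaling — the Bhattacharyya affinity is the EXACT exponential rate of the
# acceptance volume law: `(∏BCᵢ²)·e^{−√(Σσᵢ²/2)} ≤ acc(⊗) ≤ ∏BCᵢ²`, so `acc_m^{1/m} → BC₁²`

HONEST FRAMING: exact (Metropolis-corrected) sampling algorithms for lattice gauge theory;
figures of merit are autocorrelation/cost numbers at stated couplings and volumes; no
continuum-physics claim.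

Venture `LatticeQCDFlow` (cell pub-lqcd), topic `Scaling`; FANOUT row 3 (`s0-u1-a`, S0-B
implementation A, GEN-15).  NEW WORK of the cell (elementary measure theory), not a published
result; NO definition is introduced.  SETTING of row 3's `Scaling/AcceptanceVolumeFloorPi` /
`…DecayPi` (GEN-12): independent blocks `i : ι` (finite), block spaces `X i` with σ-finite
reference measures `νᵢ`, block targets `pᵢ ≥ 0` and models `qᵢ ≥ 0` (measurable, integrable; no
normalisation needed), `P = ∏ pᵢ(xᵢ)`, `Q = ∏ qᵢ(xᵢ)` on `Π i, X i` with `Measure.pi ν`, the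
acceptance `acc(⊗) = ∫∫ min(P(x)Q(x′), P(x′)Q(x)) d(⊗ν) d(⊗ν)`, block affinities
`BCᵢ = ∫√(pᵢqᵢ) dνᵢ`, block log weights `ℓᵢ = log(pᵢ/qᵢ)` and, for centring constants `cᵢ`,
`γᵢ = ∫ √(pᵢqᵢ)(ℓᵢ − cᵢ)² dνᵢ` (`γᵢ/BCᵢ = E_{ρᵢ}(ℓᵢ − cᵢ)² ≥ σᵢ² = Var_{ρᵢ} ℓᵢ` under the block
midpoint law `ρᵢ = √(pᵢqᵢ)/BCᵢ`).  The tree has `∏ accᵢ ≤ acc(⊗) ≤ ∏ BCᵢ²` — for identical blocks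
`acc₁^m ≤ acc_m ≤ (BC₁²)^m`, two DIFFERENT exponential rates unless the block flow is hit-or-miss
(GEN-13/14 rigidity).  Which is the true rate?  THIS FILE: the ceiling's.

Tools (imported): row 3's `Scaling/AcceptanceMidpointLaw` (the Jensen floor
`BC²·e^{−E_{ρ⊗ρ}|Δ log w|/2} ≤ acc` on any measure space — applied on the product space),
`Scaling/PiKernelSecondMoment` (the centred second moment of a sum of independent block terms),
`Scaling/WeightedIntegralInequalities` (weighted Cauchy–Schwarz, pair variance), `…DecayPi` (ceiling).

* §1 **`meanAccept_pi_ge_exp_sqrt`** — THE SUB-EXPONENTIAL FLOOR, general blocks: for `BCᵢ > 0`,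
  `γᵢ < ∞`: `(∏ᵢ BCᵢ²)·exp(−√((Σᵢ γᵢ/BCᵢ)/2)) ≤ acc(⊗)` (on the product space the log-weight gap
  is a sum of independent centred block gaps, so its midpoint-law mean absolute value is at most
  `√(2 Σᵢ σᵢ²)` by Cauchy–Schwarz); identical blocks **`meanAccept_pi_const_ge_exp_sqrt`** —
  `(BC₁²)^m·exp(−√(m·γ_c/(2·BC₁))) ≤ acc_m`, a correction `e^{−O(√m)}`, NOT exponential;
  **`meanAccept_pi_const_ge_exp_mul_sqrt`** — `|ℓ − c| ≤ R` on `{pq > 0}`: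
  `(BC₁²)^m·e^{−R√(m/2)} ≤ acc_m`;
* §2 **`meanAccept_pi_const_two_sided`** — `(BC₁²)^m e^{−√(mγ_c/(2BC₁))} ≤ acc_m ≤ (BC₁²)^m`;
  `log_meanAccept_pi_const_mem_Icc` — `2m·log BC₁ − √(mγ_c/(2BC₁)) ≤ log acc_m ≤ 2m·log BC₁`;
  **`tendsto_log_meanAccept_pi_const_div`** — `(log acc_m)/m → 2·log BC₁`;
  **`tendsto_meanAccept_pi_const_rpow_inv`** — `acc_m^{1/m} → BC₁²` as `m → ∞`:
  THE EXACT EXPONENTIAL RATE OF THE ACCEPTANCE OF `m` INDEPENDENT COPIES OF A BLOCK FLOW IS THE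
  BHATTACHARYYA RATE `2·log(1/BC₁)`; by GEN-13's rigidity the product floor `acc₁^m` has a
  strictly worse rate for every graded (not hit-or-miss) block flow — it is exponentially slack.

Reading (value-free): for a flow sampler that factorises over independent blocks of any
configuration space, the equilibrium acceptance of the exact (Metropolis-corrected) chain decays in
the number of blocks at exactly the rate of the squared block Bhattacharyya affinity (a HALF-moment
`BC = E_q √w` of the weight — not the block acceptance, not the ESS), with an `e^{−O(√m)}`
correction governed by the midpoint-law variance of the block log weight.  Literature context: Lee
& Neal, "Optimal scaling of the independence sampler" (Bernoulli 2018, arXiv:1511.04334 §2)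
APPROXIMATE the stationary mean acceptance of `k`-block independence proposals by a CLT for the
log-weight sum, rate `(D(q‖f) + D(f‖q))/4` in the near-perfect regime — the second-order expansion
of the exact rate `−log BC₁²` proved here for every block flow with a second log-weight moment.
The companion `Scaling/AcceptanceVolumeRateUniversal` removes the moment hypothesis from the rate
statement by truncating the target.  NOT CLAIMED: any value of ours; nothing re-scored.
-/

namespace Summit.Ventures.LatticeQCDFlow.Theory2

open MeasureTheory Finset Filter Topology

/-! ## §1 The sub-exponential floor under the Bhattacharyya ceiling -/

section FloorDep

variable {ι : Type*} [Fintype ι] {X : ι → Type*} [∀ i, MeasurableSpace (X i)]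
  {ν : (i : ι) → Measure (X i)} [∀ i, SigmaFinite (ν i)]

/-- **THE SUB-EXPONENTIAL FLOOR, GENERAL BLOCKS.**  For block densities `pᵢ, qᵢ ≥ 0` with
`BCᵢ = ∫√(pᵢqᵢ) dνᵢ > 0` and `γᵢ = ∫ √(pᵢqᵢ)(log(pᵢ/qᵢ) − cᵢ)² dνᵢ < ∞` (any constants `cᵢ`):
`(∏ᵢ BCᵢ²)·exp(−√((Σᵢ γᵢ/BCᵢ)/2)) ≤ acc(⊗pᵢ, ⊗qᵢ)` — the companion FLOOR of row 3's ceiling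
`acc(⊗pᵢ, ⊗qᵢ) ≤ ∏ᵢ BCᵢ²` (GEN-12), off by at most `exp(−√(Σᵢ σᵢ²/2))`. [ours] -/
theorem meanAccept_pi_ge_exp_sqrt {p q : (i : ι) → X i → ℝ} (hp0 : ∀ i a, 0 ≤ p i a)
    (hpm : ∀ i, Measurable (p i)) (hpi : ∀ i, Integrable (p i) (ν i)) (hq0 : ∀ i a, 0 ≤ q i a)
    (hqm : ∀ i, Measurable (q i)) (hqi : ∀ i, Integrable (q i) (ν i))
    (hB : ∀ i, 0 < ∫ a, Real.sqrt (p i a * q i a) ∂(ν i)) (c : ι → ℝ)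
    (h2 : ∀ i, Integrable (fun a => Real.sqrt (p i a * q i a) * (Real.log (p i a / q i a) - c i) ^ 2)
      (ν i)) :
    (∏ i, (∫ a, Real.sqrt (p i a * q i a) ∂(ν i)) ^ 2)
        * Real.exp (-Real.sqrt ((∑ i,
            (∫ a, Real.sqrt (p i a * q i a) * (Real.log (p i a / q i a) - c i) ^ 2 ∂(ν i))
              / ∫ a, Real.sqrt (p i a * q i a) ∂(ν i)) / 2))
      ≤ ∫ x, ∫ x', min ((∏ i, p i (x i)) * ∏ i, q i (x' i)) ((∏ i, p i (x' i)) * ∏ i, q i (x i))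
          ∂(Measure.pi ν) ∂(Measure.pi ν) := by
  classical
  set B : ι → ℝ := fun i => ∫ a, Real.sqrt (p i a * q i a) ∂(ν i) with hBdef
  set γ : ι → ℝ := fun i =>
    ∫ a, Real.sqrt (p i a * q i a) * (Real.log (p i a / q i a) - c i) ^ 2 ∂(ν i) with hγdef
  set S := ∑ i, γ i / B i with hSdef
  set μ : Measure ((i : ι) → X i) := Measure.pi ν
  set k : (i : ι) → X i → ℝ := fun i a => Real.sqrt (p i a * q i a)
  set ℓ : (i : ι) → X i → ℝ := fun i a => Real.log (p i a / q i a) with hℓ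
  have hk0 : ∀ i a, 0 ≤ k i a := fun i a => Real.sqrt_nonneg _
  have hki : ∀ i, Integrable (k i) (ν i) :=
    fun i => integrable_sqrt_mul (hp0 i) (hpm i) (hpi i) (hq0 i) (hqm i) (hqi i)
  have hℓm : ∀ i, Measurable (ℓ i) := fun i => measurable_logRatio (hpm i) (hqm i)
  have hγ0 : ∀ i, 0 ≤ γ i := fun i => integral_nonneg fun a => mul_nonneg (hk0 i a) (sq_nonneg _)
  have hS0 : 0 ≤ S := sum_nonneg fun i _ => div_nonneg (hγ0 i) (hB i).le
  have hkc : ∀ i, Integrable (fun a => k i a * (ℓ i a - c i)) (ν i) :=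
    fun i => integrable_mul_of_sq (hk0 i) (hki i) ((hℓm i).sub_const (c i)) (h2 i)
  set d : ι → ℝ := fun i => (∫ a, k i a * (ℓ i a - c i) ∂(ν i)) / B i with hd
  set g : (i : ι) → X i → ℝ := fun i a => (ℓ i a - c i) - d i with hg
  have hgm : ∀ i, Measurable (g i) := fun i => ((hℓm i).sub_const (c i)).sub_const (d i)
  have eg : ∀ i, (fun a => k i a * g i a) = fun a => k i a * (ℓ i a - c i) - d i * k i a := by
    intro i; funext a; simp only [hg]; ring
  have eg2 : ∀ i, (fun a => k i a * g i a ^ 2)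
      = fun a => k i a * (ℓ i a - c i) ^ 2 - (2 * d i) * (k i a * (ℓ i a - c i))
          + d i ^ 2 * k i a := by
    intro i; funext a; simp only [hg]; ring
  have hkg : ∀ i, Integrable (fun a => k i a * g i a) (ν i) := fun i => by
    rw [eg]; exact (hkc i).sub ((hki i).const_mul (d i))
  have hkg0 : ∀ i, ∫ a, k i a * g i a ∂(ν i) = 0 := fun i => by
    rw [eg, integral_sub (hkc i) ((hki i).const_mul (d i)), integral_const_mul, hd]
    simp only
    rw [div_mul_cancel₀ _ (hB i).ne', sub_self]
  have hkg2 : ∀ i, Integrable (fun a => k i a * g i a ^ 2) (ν i) := fun i => by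
    rw [eg2]; exact ((h2 i).sub ((hkc i).const_mul _)).add ((hki i).const_mul _)
  have hγle : ∀ i, ∫ a, k i a * g i a ^ 2 ∂(ν i) ≤ γ i := by
    intro i
    have hA : Integrable (fun a => k i a * (ℓ i a - c i) ^ 2 - (2 * d i) * (k i a * (ℓ i a - c i)))
        (ν i) := (h2 i).sub ((hkc i).const_mul _)
    have hI : ∫ a, k i a * (ℓ i a - c i) ∂(ν i) = d i * B i := by
      rw [hd]; simp only; rw [div_mul_cancel₀ _ (hB i).ne']
    have e : ∫ a, k i a * g i a ^ 2 ∂(ν i) = γ i - d i ^ 2 * B i := by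
      rw [eg2, integral_add hA ((hki i).const_mul _), integral_sub (h2 i) ((hkc i).const_mul _),
        integral_const_mul, integral_const_mul, hI]
      simp only [hγdef, hBdef]
      ring
    rw [e]
    nlinarith [sq_nonneg (d i), (hB i).le]
  obtain ⟨hP0, hPm, hPi, -⟩ := piDensity_facts (μ := ν) hp0 hpm hpi
  obtain ⟨hQ0, hQm, hQi, -⟩ := piDensity_facts (μ := ν) hq0 hqm hqi
  have hKeq : ∀ x : (i : ι) → X i, Real.sqrt ((∏ i, p i (x i)) * ∏ i, q i (x i)) = ∏ i, k i (x i) :=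
    fun x => sqrt_piDensity_mul hp0 hq0 x
  have hKi : Integrable (fun x : (i : ι) → X i => ∏ i, k i (x i)) μ :=
    Integrable.fintype_prod_dep hki
  have hK0 : ∀ x : (i : ι) → X i, 0 ≤ ∏ i, k i (x i) := fun x => prod_nonneg fun i _ => hk0 _ _
  set Z := ∏ i, B i with hZdef
  have hZpos : 0 < Z := prod_pos fun i _ => hB i
  have hZ : ∫ x, ∏ i, k i (x i) ∂μ = Z := integral_fintype_prod_eq_prod k
  have hBP : ∫ x, Real.sqrt ((∏ i, p i (x i)) * ∏ i, q i (x i)) ∂μ = Z := by simp_rw [hKeq]; exact hZ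
  set G : ((i : ι) → X i) → ℝ := fun x => ∑ i, g i (x i) with hG
  have hGm : Measurable G :=
    Finset.measurable_sum _ fun i _ => (hgm i).comp (measurable_pi_apply i)
  have hKG : Integrable (fun x => (∏ i, k i (x i)) * G x) μ := integrable_piKernel_mul_sum hki hkg
  have hKG2 : Integrable (fun x => (∏ i, k i (x i)) * G x ^ 2) μ :=
    integrable_piKernel_mul_sum_sq hk0 hki hgm hkg2
  have hQ : ∫ x, (∏ i, k i (x i)) * G x ^ 2 ∂μ
      = ∑ i, (∫ a, k i a * g i a ^ 2 ∂(ν i)) * ∏ l ∈ univ.erase i, B l :=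
    integral_piKernel_mul_sq_sum hk0 hki hgm hkg2 hkg0
  have hQle : ∫ x, (∏ i, k i (x i)) * G x ^ 2 ∂μ ≤ Z * S := by
    rw [hQ, hSdef, mul_sum]
    refine sum_le_sum fun i _ => ?_
    have hZi : (∏ l ∈ univ.erase i, B l) = Z / B i := by
      rw [eq_div_iff (hB i).ne', mul_comm, mul_prod_erase univ B (mem_univ i)]
    rw [hZi]
    calc (∫ a, k i a * g i a ^ 2 ∂(ν i)) * (Z / B i) ≤ γ i * (Z / B i) :=
          mul_le_mul_of_nonneg_right (hγle i) (div_nonneg hZpos.le (hB i).le)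
      _ = Z * (γ i / B i) := by ring
  have hKK0 : ∀ z : ((i : ι) → X i) × ((i : ι) → X i),
      0 ≤ (∏ i, k i (z.1 i)) * ∏ i, k i (z.2 i) := fun z => mul_nonneg (hK0 _) (hK0 _)
  have hKKi := hKi.mul_prod hKi
  have hTm : Measurable fun z : ((i : ι) → X i) × ((i : ι) → X i) => G z.1 - G z.2 :=
    (hGm.comp measurable_fst).sub (hGm.comp measurable_snd)
  have hKKT2 : Integrable (fun z : ((i : ι) → X i) × ((i : ι) → X i) =>
      (∏ i, k i (z.1 i)) * (∏ i, k i (z.2 i)) * (G z.1 - G z.2) ^ 2) (μ.prod μ) := by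
    have e : (fun z : ((i : ι) → X i) × ((i : ι) → X i) =>
        (∏ i, k i (z.1 i)) * (∏ i, k i (z.2 i)) * (G z.1 - G z.2) ^ 2)
        = fun z => ((∏ i, k i (z.1 i)) * G z.1 ^ 2 * ∏ i, k i (z.2 i)
            - 2 * ((∏ i, k i (z.1 i)) * G z.1 * ((∏ i, k i (z.2 i)) * G z.2)))
            + (∏ i, k i (z.1 i)) * ((∏ i, k i (z.2 i)) * G z.2 ^ 2) := by
      funext z; ring
    rw [e]
    exact ((hKG2.mul_prod hKi).sub ((hKG.mul_prod hKG).const_mul _)).add (hKi.mul_prod hKG2)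
  have hV := integral_prod_mul_mul_sq_sub (M := μ) hKi hKG hKG2
  have hCS := sq_integral_mul_abs_le hKK0 hKKi hTm hKKT2
  have hZZ : ∫ z, (∏ i, k i (z.1 i)) * ∏ i, k i (z.2 i) ∂(μ.prod μ) = Z * Z := by
    rw [integral_prod_mul (fun x : (i : ι) → X i => ∏ i, k i (x i))
      (fun x : (i : ι) → X i => ∏ i, k i (x i)), hZ]
  rw [hZZ, hV, hZ] at hCS
  set I := ∫ z, (∏ i, k i (z.1 i)) * (∏ i, k i (z.2 i)) * |G z.1 - G z.2| ∂(μ.prod μ) with hI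
  have hI0 : 0 ≤ I := integral_nonneg fun z => mul_nonneg (hKK0 z) (abs_nonneg _)
  have hI2 : I ^ 2 ≤ 2 * Z ^ 4 * S := by
    have step2 : 0 ≤ 2 * (Z * Z) * (∫ x, (∏ i, k i (x i)) * G x ∂μ) ^ 2 := by positivity
    have step3 : Z * (∫ x, (∏ i, k i (x i)) * G x ^ 2 ∂μ) ≤ Z * (Z * S) :=
      mul_le_mul_of_nonneg_left hQle hZpos.le
    nlinarith [hCS, step2, step3, hZpos.le, mul_nonneg (mul_nonneg hZpos.le hZpos.le) hZpos.le]
  have ht0 : 0 ≤ 2 * Z ^ 2 * Real.sqrt (S / 2) := by positivity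
  have hIle : I ≤ 2 * Z ^ 2 * Real.sqrt (S / 2) := by
    rw [← sq_le_sq₀ hI0 ht0, mul_pow, Real.sq_sqrt (by positivity)]
    have e2 : (2 * Z ^ 2) ^ 2 * (S / 2) = 2 * Z ^ 4 * S := by ring
    rw [e2]
    exact hI2
  have hpt : ∀ z : ((i : ι) → X i) × ((i : ι) → X i),
      Real.sqrt ((∏ i, p i (z.1 i)) * ∏ i, q i (z.1 i))
        * Real.sqrt ((∏ i, p i (z.2 i)) * ∏ i, q i (z.2 i))
        * |Real.log ((∏ i, p i (z.1 i)) / ∏ i, q i (z.1 i))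
            - Real.log ((∏ i, p i (z.2 i)) / ∏ i, q i (z.2 i))|
      = (∏ i, k i (z.1 i)) * (∏ i, k i (z.2 i)) * |G z.1 - G z.2| := by
    intro z
    simp only [hKeq, hG, hg, hℓ]
    exact piKernel_mul_abs_log_sub p q c d z.1 z.2
  have hgap := (integrable_mul_abs_of_sq hKK0 hKKi hTm hKKT2).congr
    (Eventually.of_forall fun z => (hpt z).symm)
  have hIeq := integral_congr_ae (μ := μ.prod μ) (Eventually.of_forall hpt)
  have hfloor := sq_integral_sqrt_mul_exp_le_meanAccept (μ := μ) hP0 hPm hPi hQ0 hQm hQi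
    (by rwa [hBP]) hgap
  rw [hIeq, hBP] at hfloor
  refine le_trans ?_ hfloor
  rw [prod_pow]
  refine mul_le_mul_of_nonneg_left (Real.exp_le_exp.2 ?_) (sq_nonneg _)
  rw [neg_div, neg_le_neg_iff, div_le_iff₀ (by positivity)]
  calc I ≤ 2 * Z ^ 2 * Real.sqrt (S / 2) := hIle
    _ = Real.sqrt (S / 2) * (2 * Z ^ 2) := by ring

end FloorDep

section Floor

variable {ι : Type*} [Fintype ι] {Y : Type*} [MeasurableSpace Y] {ν : Measure Y} [SigmaFinite ν]

/-- **THE SUB-EXPONENTIAL FLOOR, IDENTICAL BLOCKS.**  For `p, q ≥ 0` with `BC₁ = ∫√(pq) dν > 0`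
and `γ_c = ∫ √(pq)(log(p/q) − c)² dν < ∞`, on `m = card ι` independent identical blocks:
`(BC₁²)^m · exp(−√(m·γ_c/(2·BC₁))) ≤ acc_m`; with the ceiling `acc_m ≤ (BC₁²)^m` (GEN-12) the
correction is `e^{−O(√m)}`: the Bhattacharyya rate is exact. [ours] -/
theorem meanAccept_pi_const_ge_exp_sqrt {p q : Y → ℝ} (hp0 : ∀ a, 0 ≤ p a) (hpm : Measurable p)
    (hpi : Integrable p ν) (hq0 : ∀ a, 0 ≤ q a) (hqm : Measurable q) (hqi : Integrable q ν)
    (hB : 0 < ∫ a, Real.sqrt (p a * q a) ∂ν) (c : ℝ)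
    (h2 : Integrable (fun a => Real.sqrt (p a * q a) * (Real.log (p a / q a) - c) ^ 2) ν) :
    ((∫ a, Real.sqrt (p a * q a) ∂ν) ^ 2) ^ Fintype.card ι
        * Real.exp (-Real.sqrt (Fintype.card ι
            * (∫ a, Real.sqrt (p a * q a) * (Real.log (p a / q a) - c) ^ 2 ∂ν)
            / (2 * ∫ a, Real.sqrt (p a * q a) ∂ν)))
      ≤ ∫ x, ∫ x', min ((∏ i, p (x i)) * ∏ i, q (x' i)) ((∏ i, p (x' i)) * ∏ i, q (x i))
          ∂(Measure.pi fun _ : ι => ν) ∂(Measure.pi fun _ : ι => ν) := by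
  have h := meanAccept_pi_ge_exp_sqrt (X := fun _ : ι => Y) (ν := fun _ : ι => ν)
    (p := fun _ => p) (q := fun _ => q) (fun _ => hp0) (fun _ => hpm) (fun _ => hpi) (fun _ => hq0)
    (fun _ => hqm) (fun _ => hqi) (fun _ => hB) (fun _ => c) fun _ => h2
  rw [prod_const, card_univ, sum_const, card_univ, nsmul_eq_mul] at h
  convert h using 4
  field_simp

/-- **THE SUB-EXPONENTIAL FLOOR, BOUNDED BLOCK LOG WEIGHT.**  If `|log(p/q) − c| ≤ R` wherever
`p q > 0` then on `m` independent identical blocks `(BC₁²)^m · e^{−R√(m/2)} ≤ acc_m`. [ours] -/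
theorem meanAccept_pi_const_ge_exp_mul_sqrt {p q : Y → ℝ} (hp0 : ∀ a, 0 ≤ p a)
    (hpm : Measurable p) (hpi : Integrable p ν) (hq0 : ∀ a, 0 ≤ q a) (hqm : Measurable q)
    (hqi : Integrable q ν) (hB : 0 < ∫ a, Real.sqrt (p a * q a) ∂ν) {c R : ℝ} (hR : 0 ≤ R)
    (hbd : ∀ a, 0 < p a → 0 < q a → |Real.log (p a / q a) - c| ≤ R) :
    ((∫ a, Real.sqrt (p a * q a) ∂ν) ^ 2) ^ Fintype.card ι
        * Real.exp (-(R * Real.sqrt (Fintype.card ι / 2)))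
      ≤ ∫ x, ∫ x', min ((∏ i, p (x i)) * ∏ i, q (x' i)) ((∏ i, p (x' i)) * ∏ i, q (x i))
          ∂(Measure.pi fun _ : ι => ν) ∂(Measure.pi fun _ : ι => ν) := by
  set B := ∫ a, Real.sqrt (p a * q a) ∂ν with hBdef
  obtain ⟨h2, hγ⟩ := integral_sqrt_mul_logWeight_sq_le hp0 hpm hpi hq0 hqm hqi hbd
  have hfloor := meanAccept_pi_const_ge_exp_sqrt (ι := ι) hp0 hpm hpi hq0 hqm hqi hB c h2
  refine le_trans (mul_le_mul_of_nonneg_left (Real.exp_le_exp.2 ?_)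
    (pow_nonneg (sq_nonneg _) _)) hfloor
  rw [neg_le_neg_iff]
  have hs : Real.sqrt (Fintype.card ι
      * (∫ a, Real.sqrt (p a * q a) * (Real.log (p a / q a) - c) ^ 2 ∂ν) / (2 * B))
      ≤ Real.sqrt (R ^ 2 * (Fintype.card ι / 2)) := by
    refine Real.sqrt_le_sqrt ?_
    rw [div_le_iff₀ (by positivity)]
    have hm0 : (0 : ℝ) ≤ Fintype.card ι := Nat.cast_nonneg _
    have := mul_le_mul_of_nonneg_left hγ hm0
    nlinarith
  rwa [Real.sqrt_mul (sq_nonneg R), Real.sqrt_sq hR] at hs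

end Floor

/-! ## §2 The exact exponential rate -/

section Rate

variable {Y : Type*} [MeasurableSpace Y] {ν : Measure Y} [SigmaFinite ν]

/-- **THE TWO-SIDED VOLUME LAW WITH ONE RATE.**  For block densities `p, q ≥ 0` with
`BC₁ = ∫√(pq) > 0` and `γ_c = ∫√(pq)(log(p/q) − c)² < ∞`, on `m = card ι` independent identical
blocks: `(BC₁²)^m · exp(−√(m·γ_c/(2·BC₁))) ≤ acc_m ≤ (BC₁²)^m`. [ours] -/
theorem meanAccept_pi_const_two_sided {ι : Type*} [Fintype ι] {p q : Y → ℝ} (hp0 : ∀ a, 0 ≤ p a)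
    (hpm : Measurable p) (hpi : Integrable p ν) (hq0 : ∀ a, 0 ≤ q a) (hqm : Measurable q)
    (hqi : Integrable q ν) (hB : 0 < ∫ a, Real.sqrt (p a * q a) ∂ν) (c : ℝ)
    (h2 : Integrable (fun a => Real.sqrt (p a * q a) * (Real.log (p a / q a) - c) ^ 2) ν) :
    ((∫ a, Real.sqrt (p a * q a) ∂ν) ^ 2) ^ Fintype.card ι
        * Real.exp (-Real.sqrt (Fintype.card ι
            * (∫ a, Real.sqrt (p a * q a) * (Real.log (p a / q a) - c) ^ 2 ∂ν)
            / (2 * ∫ a, Real.sqrt (p a * q a) ∂ν)))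
      ≤ ∫ x, ∫ x', min ((∏ i, p (x i)) * ∏ i, q (x' i)) ((∏ i, p (x' i)) * ∏ i, q (x i))
          ∂(Measure.pi fun _ : ι => ν) ∂(Measure.pi fun _ : ι => ν) ∧
    ∫ x, ∫ x', min ((∏ i, p (x i)) * ∏ i, q (x' i)) ((∏ i, p (x' i)) * ∏ i, q (x i))
          ∂(Measure.pi fun _ : ι => ν) ∂(Measure.pi fun _ : ι => ν)
      ≤ ((∫ a, Real.sqrt (p a * q a) ∂ν) ^ 2) ^ Fintype.card ι :=
  ⟨meanAccept_pi_const_ge_exp_sqrt hp0 hpm hpi hq0 hqm hqi hB c h2,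
    (meanAccept_pi_const_mem_Icc (ι := ι) hp0 hpm hpi hq0 hqm hqi).2⟩

/-- **Logarithmic form**: `2m·log BC₁ − √(m·γ_c/(2·BC₁)) ≤ log acc_m ≤ 2m·log BC₁`. [ours] -/
theorem log_meanAccept_pi_const_mem_Icc {ι : Type*} [Fintype ι] {p q : Y → ℝ}
    (hp0 : ∀ a, 0 ≤ p a) (hpm : Measurable p) (hpi : Integrable p ν) (hq0 : ∀ a, 0 ≤ q a)
    (hqm : Measurable q) (hqi : Integrable q ν) (hB : 0 < ∫ a, Real.sqrt (p a * q a) ∂ν) (c : ℝ)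
    (h2 : Integrable (fun a => Real.sqrt (p a * q a) * (Real.log (p a / q a) - c) ^ 2) ν) :
    Real.log (∫ x, ∫ x', min ((∏ i, p (x i)) * ∏ i, q (x' i)) ((∏ i, p (x' i)) * ∏ i, q (x i))
          ∂(Measure.pi fun _ : ι => ν) ∂(Measure.pi fun _ : ι => ν))
      ∈ Set.Icc (2 * Fintype.card ι * Real.log (∫ a, Real.sqrt (p a * q a) ∂ν)
          - Real.sqrt (Fintype.card ι
              * (∫ a, Real.sqrt (p a * q a) * (Real.log (p a / q a) - c) ^ 2 ∂ν)
              / (2 * ∫ a, Real.sqrt (p a * q a) ∂ν)))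
        (2 * Fintype.card ι * Real.log (∫ a, Real.sqrt (p a * q a) ∂ν)) := by
  obtain ⟨hlo, hhi⟩ := meanAccept_pi_const_two_sided (ι := ι) hp0 hpm hpi hq0 hqm hqi hB c h2
  set B := ∫ a, Real.sqrt (p a * q a) ∂ν with hBdef
  have hpow : 0 < (B ^ 2) ^ Fintype.card ι := pow_pos (pow_pos hB 2) _
  have hpos : 0 < (B ^ 2) ^ Fintype.card ι * Real.exp (-Real.sqrt (Fintype.card ι
      * (∫ a, Real.sqrt (p a * q a) * (Real.log (p a / q a) - c) ^ 2 ∂ν) / (2 * B))) :=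
    mul_pos hpow (Real.exp_pos _)
  have hacc := lt_of_lt_of_le hpos hlo
  have hlogpow : Real.log ((B ^ 2) ^ Fintype.card ι) = 2 * Fintype.card ι * Real.log B := by
    rw [Real.log_pow, Real.log_pow]; push_cast; ring
  constructor
  · have h := Real.log_le_log hpos hlo
    rwa [Real.log_mul hpow.ne' (Real.exp_pos _).ne', Real.log_exp, hlogpow, ← sub_eq_add_neg] at h
  · have h := Real.log_le_log hacc hhi
    rwa [hlogpow] at h

/-- **THE EXACT EXPONENTIAL RATE, LOGARITHMIC FORM.**  For block densities `p, q ≥ 0` with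
`BC₁ = ∫√(pq) > 0` and a finite second moment `∫√(pq)(log(p/q) − c)² < ∞` of the block log weight
under the midpoint law (some `c`): `(1/m)·log acc_m → 2·log BC₁` as the number `m` of independent
identical blocks tends to infinity. [ours] -/
theorem tendsto_log_meanAccept_pi_const_div {p q : Y → ℝ} (hp0 : ∀ a, 0 ≤ p a)
    (hpm : Measurable p) (hpi : Integrable p ν) (hq0 : ∀ a, 0 ≤ q a) (hqm : Measurable q)
    (hqi : Integrable q ν) (hB : 0 < ∫ a, Real.sqrt (p a * q a) ∂ν) (c : ℝ)
    (h2 : Integrable (fun a => Real.sqrt (p a * q a) * (Real.log (p a / q a) - c) ^ 2) ν) :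
    Tendsto (fun m : ℕ => Real.log (∫ x, ∫ x', min ((∏ i : Fin m, p (x i)) * ∏ i, q (x' i))
          ((∏ i, p (x' i)) * ∏ i, q (x i)) ∂(Measure.pi fun _ : Fin m => ν)
          ∂(Measure.pi fun _ : Fin m => ν)) / m) atTop
      (𝓝 (2 * Real.log (∫ a, Real.sqrt (p a * q a) ∂ν))) := by
  set B := ∫ a, Real.sqrt (p a * q a) ∂ν with hBdef
  set γ := ∫ a, Real.sqrt (p a * q a) * (Real.log (p a / q a) - c) ^ 2 ∂ν with hγdef
  have hγ0 : 0 ≤ γ := integral_nonneg fun a => mul_nonneg (Real.sqrt_nonneg _) (sq_nonneg _)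
  set s := Real.sqrt (γ / (2 * B)) with hs
  -- the lower envelope `2 log B − s·√(1/m)` tends to `2 log B`
  have hL : Tendsto (fun m : ℕ => 2 * Real.log B - s * Real.sqrt ((m : ℝ)⁻¹)) atTop
      (𝓝 (2 * Real.log B)) := by
    have h := (tendsto_inv_atTop_nhds_zero_nat (𝕜 := ℝ)).sqrt.const_mul s
    rw [Real.sqrt_zero, mul_zero] at h
    simpa using (tendsto_const_nhds (x := 2 * Real.log B)).sub h
  refine tendsto_of_tendsto_of_tendsto_of_le_of_le' hL tendsto_const_nhds ?_ ?_
  · filter_upwards [eventually_gt_atTop 0] with m hm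
    have hmr : (0 : ℝ) < m := Nat.cast_pos.2 hm
    have h := (log_meanAccept_pi_const_mem_Icc (ι := Fin m) hp0 hpm hpi hq0 hqm hqi hB c h2).1
    rw [Fintype.card_fin] at h
    rw [le_div_iff₀ hmr]
    have e : s * Real.sqrt ((m : ℝ)⁻¹) * m = Real.sqrt (m * γ / (2 * B)) := by
      rw [hs, Real.sqrt_inv, ← Real.sqrt_div_self, mul_div_assoc', div_mul_cancel₀ _ hmr.ne',
        ← Real.sqrt_mul' _ hmr.le]
      congr 1
      field_simp
    calc (2 * Real.log B - s * Real.sqrt ((m : ℝ)⁻¹)) * m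
        = 2 * m * Real.log B - s * Real.sqrt ((m : ℝ)⁻¹) * m := by ring
      _ = 2 * m * Real.log B - Real.sqrt (m * γ / (2 * B)) := by rw [e]
      _ ≤ _ := h
  · filter_upwards [eventually_gt_atTop 0] with m hm
    have hmr : (0 : ℝ) < m := Nat.cast_pos.2 hm
    have h := (log_meanAccept_pi_const_mem_Icc (ι := Fin m) hp0 hpm hpi hq0 hqm hqi hB c h2).2
    rw [Fintype.card_fin] at h
    rw [div_le_iff₀ hmr]
    linarith

/-- **THE EXACT EXPONENTIAL RATE.**  Under the same hypotheses, `acc_m^{1/m} → BC₁²`: the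
equilibrium acceptance of the exact sampler built on `m` independent copies of a block flow decays
at EXACTLY the rate of the squared block Bhattacharyya affinity (the ceiling of row 3's geometric
law is tight on the exponential scale; by GEN-13's rigidity the floor `acc₁^m` is not, unless the
block flow is hit-or-miss). [ours] -/
theorem tendsto_meanAccept_pi_const_rpow_inv {p q : Y → ℝ} (hp0 : ∀ a, 0 ≤ p a)
    (hpm : Measurable p) (hpi : Integrable p ν) (hq0 : ∀ a, 0 ≤ q a) (hqm : Measurable q)
    (hqi : Integrable q ν) (hB : 0 < ∫ a, Real.sqrt (p a * q a) ∂ν) (c : ℝ)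
    (h2 : Integrable (fun a => Real.sqrt (p a * q a) * (Real.log (p a / q a) - c) ^ 2) ν) :
    Tendsto (fun m : ℕ => (∫ x, ∫ x', min ((∏ i : Fin m, p (x i)) * ∏ i, q (x' i))
          ((∏ i, p (x' i)) * ∏ i, q (x i)) ∂(Measure.pi fun _ : Fin m => ν)
          ∂(Measure.pi fun _ : Fin m => ν)) ^ (1 / (m : ℝ))) atTop
      (𝓝 ((∫ a, Real.sqrt (p a * q a) ∂ν) ^ 2)) := by
  set B := ∫ a, Real.sqrt (p a * q a) ∂ν with hBdef
  have hlog := tendsto_log_meanAccept_pi_const_div hp0 hpm hpi hq0 hqm hqi hB c h2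
  have hexp := (Real.continuous_exp.tendsto _).comp hlog
  have hB2 : Real.exp (2 * Real.log B) = B ^ 2 := by
    rw [← Real.exp_log (pow_pos hB 2), Real.log_pow]; norm_num
  rw [hB2] at hexp
  refine hexp.congr' (Eventually.of_forall fun m => ?_)
  have hacc : 0 < ∫ x, ∫ x', min ((∏ i : Fin m, p (x i)) * ∏ i, q (x' i))
      ((∏ i, p (x' i)) * ∏ i, q (x i)) ∂(Measure.pi fun _ : Fin m => ν)
      ∂(Measure.pi fun _ : Fin m => ν) :=
    lt_of_lt_of_le (mul_pos (pow_pos (pow_pos hB 2) _) (Real.exp_pos _))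
      (meanAccept_pi_const_two_sided (ι := Fin m) hp0 hpm hpi hq0 hqm hqi hB c h2).1
  simp only [Function.comp_apply]
  rw [Real.rpow_def_of_pos hacc, div_eq_mul_one_div]

end Rate

end Summit.Ventures.LatticeQCDFlow.Theory2
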